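import Literature.AnabelianGeometry.SemiGraphs.CosetCategories
import HarnessLib

/-!
# The small coset category is invariant under isomorphisms of topological groups (equivalence of `𝓑(G)⁰`'s)

[FrdII] S. Mochizuki, *The geometry of Frobenioids II*, Example 1.3 (ii) p. 11 (the pull-back functor between coset
categories along a continuous surjection) [cite: MochizukiFrdII2008, Ex 1.3 (ii) p.11]; [IUTchI] Example 3.3 (i) p. 77
(`𝒟_v := 𝓑(X̲→_v̲)⁰`, a category attached to a profinite group, determined up to equivalence).

PROOF-ONLY companion (theorems only; no definitions, no instances) of `CosetCategories.lean` (abc-iut-L5-t2 gen 3):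
* `CosetCat.pull_essSurj_of_injective` — along a continuous OPEN BIJECTIVE homomorphism `aug : P → G` (an isomorphism
  of topological groups) the full and faithful pull-back functor `pull aug : CosetCat G ⥤ CosetCat P` is also
  essentially surjective (`P/U = aug⁻¹(aug U)`), hence an equivalence (`pull_isEquivalence_of_injective`);
* `CosetCat.nonempty_equivalence_of_continuousMulEquiv` — `P ≃ₜ* G` gives `CosetCat G ≌ CosetCat P`;
* `CosetCat.nonempty_equivalence_of_conj` — for a subgroup `H` of a topological group and `g`, conjugation
  `H ≃ₜ* gHg⁻¹` gives `CosetCat H ≌ CosetCat (gHg⁻¹)`: the coset category of a subgroup "defined up to conjugacy" is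
  defined up to equivalence (used for `𝒟_v̲ = 𝓑(Π_v̲)⁰`, `Π_v̲` defined up to inner automorphism, abc-iut-L5-t2
  `InitialThetaDataLocalConjugacy`).
Pure topological-group / category theory over Mathlib; nothing of the disputed series is asserted.
-/

noncomputable section

namespace Literature.AnabelianGeometry.SemiGraphs

open CategoryTheory
open scoped Pointwise

universe u

namespace CosetCat

variable {G : Type u} [Group G] [TopologicalSpace G] {P : Type u} [Group P] [TopologicalSpace P]

/-- Along a continuous open INJECTIVE surjection `aug : P → G`, every `P/U` is the pull-back of `G/aug(U)`: the
pull-back functor is essentially surjective. [cite: MochizukiFrdII2008, Ex 1.3 (ii) p.11] -/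
theorem pull_essSurj_of_injective (aug : P →* G) (hc : Continuous aug) (hs : Function.Surjective aug)
    (hi : Function.Injective aug) (ho : IsOpenMap aug) : (pull aug hc hs).EssSurj where
  mem_essImage X := by
    refine ⟨⟨mapOpen aug ho X.sg⟩, ⟨eqToIso (CosetCat.ext (OpenSubgroup.ext fun π => ?_))⟩⟩
    change π ∈ (mapOpen aug ho X.sg).comap aug hc ↔ π ∈ X.sg
    rw [OpenSubgroup.mem_comap, mem_mapOpen]
    constructor
    · rintro ⟨π', hπ', h⟩
      rwa [← hi h]
    · intro hπ
      exact ⟨π, hπ, rfl⟩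

/-- Along a continuous open bijective homomorphism the pull-back functor is an EQUIVALENCE of coset categories.
[cite: MochizukiFrdII2008, Ex 1.3 (ii) p.11] -/
theorem pull_isEquivalence_of_injective (aug : P →* G) (hc : Continuous aug) (hs : Function.Surjective aug)
    (hi : Function.Injective aug) (ho : IsOpenMap aug) : (pull aug hc hs).IsEquivalence :=
  haveI := pull_full aug hc hs
  haveI := pull_faithful aug hc hs
  haveI := pull_essSurj_of_injective aug hc hs hi ho
  {}

/-- **An isomorphism of topological groups `P ≃ₜ* G` induces an equivalence `CosetCat G ≌ CosetCat P`** (the small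
coset category is an invariant of the topological group). [cite: MochizukiFrdII2008, Ex 1.3 (ii) p.11] -/
theorem nonempty_equivalence_of_continuousMulEquiv (e : P ≃ₜ* G) : Nonempty (CosetCat G ≌ CosetCat P) :=
  haveI := pull_isEquivalence_of_injective e.toMonoidHom e.toHomeomorph.continuous e.surjective e.injective
    e.toHomeomorph.isOpenMap
  ⟨(pull e.toMonoidHom e.toHomeomorph.continuous e.surjective).asEquivalence⟩

/-! ### Conjugate subgroups have equivalent coset categories -/

/-- Conjugation by `g` is an isomorphism of topological groups `H ≃ₜ* gHg⁻¹` (Mathlib's `Subgroup.equivSMul` is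
continuous both ways). [cite: MochizukiFrdII2008, Ex 1.3 (ii) p.11] -/
theorem nonempty_continuousMulEquiv_conj [IsTopologicalGroup G] (H : Subgroup G) (g : G) :
    Nonempty (H ≃ₜ* (MulAut.conj g • H : Subgroup G)) := by
  refine ⟨{ Subgroup.equivSMul (MulAut.conj g) H with
    continuous_toFun := ?_, continuous_invFun := ?_ }⟩
  · refine Continuous.subtype_mk ?_ _
    exact ((continuous_const.mul continuous_subtype_val).mul continuous_const)
  · refine Continuous.subtype_mk ?_ _
    exact ((continuous_const.mul continuous_subtype_val).mul continuous_const)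

/-- **Conjugate subgroups have equivalent coset categories**: `CosetCat H ≌ CosetCat (gHg⁻¹)` — a subgroup defined up
to conjugacy (e.g. `Π_v̲` of [IUTchI] Def. 3.1 (f), defined up to inner automorphism) has a coset category
`𝓑(·)⁰` defined up to equivalence. [cite: MochizukiFrdII2008, Ex 1.3 (ii) p.11] -/
theorem nonempty_equivalence_of_conj [IsTopologicalGroup G] (H : Subgroup G) (g : G) :
    Nonempty (CosetCat (MulAut.conj g • H : Subgroup G) ≌ CosetCat H) := by
  obtain ⟨e⟩ := nonempty_continuousMulEquiv_conj H g
  exact nonempty_equivalence_of_continuousMulEquiv e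

end CosetCat

end Literature.AnabelianGeometry.SemiGraphs

end
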